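import Summits.QuantumFields.YangMills.Theorems.ColdStartUniversalityLatticeLangevinBatchMeansInMeasure
import Summits.QuantumFields.YangMills.Theorems.ColdStartUniversalityLatticeLangevinGreenKuboBilinear
import Summits.QuantumFields.YangMills.Theorems.ColdStartUniversalityLatticeLangevinInMeasureAlgebra
import HarnessLib

/-!
# Route `ColdStartUniversality` (fixed-cut-off SZZ dynamics, sampler package): ★★★ CONSISTENT ESTIMATION OF THE GREEN–KUBO COVARIANCE MATRIX —
# batch means of linear combinations and the polarised batch-covariance estimator

Helper file (seat `ym-line-csu-p1`, g35; `--supports stmt-QuantumFields-24809`).  For finitely many continuous observables `|Gₖ| ≤ 1` with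
Green–Kubo covariance matrix `S` (file 99b) and every strong solution of the SU(2) SZZ dynamics from a deterministic start:
* `dotProduct_mulVec_greenKubo_eq` — the quadratic form of `S` is twice the Green–Kubo form of the combination: `aᵀSa = σ²(Σ aₖGₖ)`;
* ★★★ `tendstoInMeasure_batchMeans_combination` — for `Σ|aₖ| ≤ 1` the centred batch-means estimator computed from the path of `Σₖ aₖGₖ(U_r)`
  converges IN PROBABILITY to `aᵀSa` along every block scheme `b_n → ∞`, `J_n → ∞`, `b_n/J_n → 0` (file 95a + bilinearity, file 99a);
* ★★★ `tendstoInMeasure_batchCovariance` — POLARISATION: with `a± = (eₖ ± e_l)/2` the difference of the two batch-means estimators converges in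
  probability to the matrix entry `S k l`; i.e. the batch-covariance matrix is a consistent estimator of `S` (input of the studentised delta method).
THEOREMS ONLY, no definition, no sorry; [folklore].
HONEST FRAMING: fixed cut-off; `S` depends on `L, β'`; `UniformColdStartMixing` (24809) is NOT restated; no crux, rung or summit statement is
proved; the Yang–Mills mass gap is NOT proved.
-/

set_option autoImplicit false

noncomputable section

namespace Summit.QuantumFields.YangMills.Theorems.ColdStartUniversality

open MeasureTheory ProbabilityTheory Filter Topology Set Matrix
open scoped NNReal ENNReal BigOperators
open Literature Literature.Probability.Process Literature.MathematicalPhysics.QuantumFieldTheory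
open Literature.MathematicalPhysics.QuantumLattice (fundamentalRep fundamentalLatticeRep continuous_fundamentalRep)

variable {L : ℕ} [NeZero L]

/-- ★★ The quadratic form of the Green–Kubo covariance matrix is twice the Green–Kubo form of the linear combination:
`aᵀ S a = 2∫₀^∞⟨Ĝ_a, κ_tĜ_a⟩_μ dt` with `G_a = Σₖ aₖGₖ`. [folklore] -/
theorem dotProduct_mulVec_greenKubo_eq (L : ℕ) [NeZero L] (β' : ℝ)
    (κ : ℝ≥0 → Kernel (GaugeConfig 3 L (Matrix.specialUnitaryGroup (Fin 2) ℂ))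
      (GaugeConfig 3 L (Matrix.specialUnitaryGroup (Fin 2) ℂ))) [∀ t, IsMarkovKernel (κ t)]
    (hreal : ∀ (t : ℝ≥0) (x : GaugeConfig 3 L (Matrix.specialUnitaryGroup (Fin 2) ℂ))
        (Ω : Type) [MeasurableSpace Ω] (P : Measure Ω) [IsProbabilityMeasure P]
        (W : ℝ≥0 → Ω → (Edge 3 L × NoiseIdx 2 → ℝ)) (hW : IsFlatBrownian W P)
        (U : ℝ≥0 → Ω → GaugeConfig 3 L (Matrix.specialUnitaryGroup (Fin 2) ℂ)),
        (∀ ω, U 0 ω = x) →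
        (latticeLangevinDynamics (fundamentalLatticeRep 2) β').IsSolution (fundamentalRep (Fin 2))
          hW.natFiltration P W U →
        κ t x = P.map (U t))
    {ι : Type} [Fintype ι]
    {G : ι → GaugeConfig 3 L (Matrix.specialUnitaryGroup (Fin 2) ℂ) → ℝ} (hGc : ∀ i, Continuous (G i)) (hG1 : ∀ i z, |G i z| ≤ 1)
    {S : Matrix ι ι ℝ}
    (hS : S = fun i j => ∫ t in Ioi (0 : ℝ),
      (∫ y, ((G i y - ∫ z, G i z ∂(wilsonMeasure (d := 3) (L := L) (fundamentalRep (Fin 2)) β')) *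
          (∫ z, (G j z - ∫ z', G j z' ∂(wilsonMeasure (d := 3) (L := L) (fundamentalRep (Fin 2)) β')) ∂(κ t.toNNReal y)) +
        (G j y - ∫ z, G j z ∂(wilsonMeasure (d := 3) (L := L) (fundamentalRep (Fin 2)) β')) *
          (∫ z, (G i z - ∫ z', G i z' ∂(wilsonMeasure (d := 3) (L := L) (fundamentalRep (Fin 2)) β')) ∂(κ t.toNNReal y)))
        ∂(wilsonMeasure (d := 3) (L := L) (fundamentalRep (Fin 2)) β')))
    (a : ι → ℝ) :
    a ⬝ᵥ S *ᵥ a = 2 * ∫ t in Ioi (0 : ℝ), (∫ y, ((∑ i, a i * G i y) - ∫ z, (∑ i, a i * G i z) ∂(wilsonMeasure (d := 3) (L := L) (fundamentalRep (Fin 2)) β')) *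
      (∫ z, ((∑ i, a i * G i z) - ∫ z', (∑ i, a i * G i z') ∂(wilsonMeasure (d := 3) (L := L) (fundamentalRep (Fin 2)) β'))
        ∂(κ t.toNNReal y)) ∂(wilsonMeasure (d := 3) (L := L) (fundamentalRep (Fin 2)) β')) := by
  classical
  haveI := secondCountableTopology_su2
  haveI := borelSpace_config L
  set μ : Measure (GaugeConfig 3 L (Matrix.specialUnitaryGroup (Fin 2) ℂ)) :=
    wilsonMeasure (d := 3) (L := L) (fundamentalRep (Fin 2)) β' with hμ
  haveI : IsProbabilityMeasure μ :=
    isProbabilityMeasure_wilsonMeasure (d := 3) (L := L) (fundamentalRep (Fin 2)) (continuous_fundamentalRep (Fin 2)) β'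
  set m : ι → ℝ := fun i => ∫ z, G i z ∂μ with hm
  set Gh : ι → GaugeConfig 3 L (Matrix.specialUnitaryGroup (Fin 2) ℂ) → ℝ := fun i z => G i z - m i with hGh
  have hGhc : ∀ i, Continuous (Gh i) := fun i => (hGc i).sub continuous_const
  have hm1 : ∀ i, |m i| ≤ 1 := fun i => by
    have hh := norm_integral_le_of_norm_le_const (μ := μ) (f := G i) (C := 1)
      (Eventually.of_forall fun z => by simpa [Real.norm_eq_abs] using hG1 i z)
    simpa [Real.norm_eq_abs] using hh
  have hGhb : ∀ i z, |Gh i z| ≤ 2 := fun i z => (abs_sub _ _).trans (by linarith [hG1 i z, hm1 i])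
  set C : ι → ι → ℝ := fun i j => ∫ t in Ioi (0 : ℝ), (∫ y, Gh i y * (∫ z, Gh j z ∂(κ t.toNNReal y)) ∂μ) with hC
  have hcross : ∀ i j, IntegrableOn (fun t : ℝ => ∫ y, Gh i y * (∫ z, Gh j z ∂(κ t.toNNReal y)) ∂μ) (Ioi (0 : ℝ)) := fun i j =>
    (integrableOn_crossCorrelation L β' κ hreal (hGhc i) (hGhb i) (hGc j) (hG1 j)).2
  have hκm : ∀ j (t : ℝ≥0), Measurable fun y => ∫ z, Gh j z ∂(κ t y) := fun j t =>
    ((hGhc j).measurable.stronglyMeasurable.integral_kernel (κ := κ t)).measurable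
  have hκb : ∀ j (t : ℝ≥0) y, |∫ z, Gh j z ∂(κ t y)| ≤ 2 := fun j t y => by
    have hh := norm_integral_le_of_norm_le_const (μ := κ t y) (f := Gh j) (C := 2)
      (Eventually.of_forall fun z => by simpa [Real.norm_eq_abs] using hGhb j z)
    simpa [Real.norm_eq_abs] using hh
  have hprodi : ∀ i j (t : ℝ≥0), Integrable (fun y => Gh i y * ∫ z, Gh j z ∂(κ t y)) μ := fun i j t =>
    (integrable_const (2 * 2 : ℝ)).mono' ((hGhc i).measurable.mul (hκm j t)).aestronglyMeasurable
      (Eventually.of_forall fun y => by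
        rw [Real.norm_eq_abs, abs_mul]; exact mul_le_mul (hGhb i y) (hκb j t y) (abs_nonneg _) (by norm_num))
  have hSij : ∀ i j, S i j = C i j + C j i := fun i j => by
    rw [hS]
    simp only [hC]
    rw [← integral_add (hcross i j) (hcross j i)]
    exact integral_congr_ae (ae_of_all _ fun t => (integral_add (hprodi i j _) (hprodi j i _)))
  have hquad : a ⬝ᵥ (S *ᵥ a) = 2 * ∑ i, ∑ j, a i * a j * C i j := by
    simp only [dotProduct, mulVec, hSij]
    have h1 : ∑ i, a i * ∑ j, (C i j + C j i) * a j = (∑ i, ∑ j, a i * a j * C i j) + ∑ i, ∑ j, a i * a j * C j i := by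
      rw [← Finset.sum_add_distrib]
      refine Finset.sum_congr rfl fun i _ => ?_
      rw [Finset.mul_sum, ← Finset.sum_add_distrib]
      exact Finset.sum_congr rfl fun j _ => by ring
    have h2 : ∑ i, ∑ j, a i * a j * C j i = ∑ i, ∑ j, a i * a j * C i j := by
      rw [Finset.sum_comm]
      exact Finset.sum_congr rfl fun i _ => Finset.sum_congr rfl fun j _ => by ring
    rw [h1, h2]; ring
  have hcen : ∀ z, (∑ i, a i * G i z) - ∫ z', (∑ i, a i * G i z') ∂μ = ∑ i, a i * Gh i z := fun z => by
    rw [integral_sum_mul_eq L hGc hG1 a μ, ← Finset.sum_sub_distrib]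
    exact Finset.sum_congr rfl fun i _ => by simp only [hGh]; ring
  rw [hquad]
  simp_rw [hcen]
  rw [greenKubo_sum_eq L β' κ hreal hGc hG1 a]

/-- ★★★ **Batch means of a linear combination are consistent for `aᵀSa`** (`Σ|aₖ| ≤ 1`; every block scheme `b_n → ∞, J_n → ∞, b_n/J_n → 0`;
every strong solution from a deterministic start; fixed cut-off). [folklore] -/
theorem tendstoInMeasure_batchMeans_combination (L : ℕ) [NeZero L] (β' : ℝ)
    (κ : ℝ≥0 → Kernel (GaugeConfig 3 L (Matrix.specialUnitaryGroup (Fin 2) ℂ))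
      (GaugeConfig 3 L (Matrix.specialUnitaryGroup (Fin 2) ℂ))) [∀ t, IsMarkovKernel (κ t)]
    (hreal : ∀ (t : ℝ≥0) (x : GaugeConfig 3 L (Matrix.specialUnitaryGroup (Fin 2) ℂ))
        (Ω : Type) [MeasurableSpace Ω] (P : Measure Ω) [IsProbabilityMeasure P]
        (W : ℝ≥0 → Ω → (Edge 3 L × NoiseIdx 2 → ℝ)) (hW : IsFlatBrownian W P)
        (U : ℝ≥0 → Ω → GaugeConfig 3 L (Matrix.specialUnitaryGroup (Fin 2) ℂ)),
        (∀ ω, U 0 ω = x) →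
        (latticeLangevinDynamics (fundamentalLatticeRep 2) β').IsSolution (fundamentalRep (Fin 2))
          hW.natFiltration P W U →
        κ t x = P.map (U t))
    (x : GaugeConfig 3 L (Matrix.specialUnitaryGroup (Fin 2) ℂ))
    {Ω : Type} [MeasurableSpace Ω] {P : Measure Ω} [IsProbabilityMeasure P]
    {W : ℝ≥0 → Ω → (Edge 3 L × NoiseIdx 2 → ℝ)} (hW : IsFlatBrownian W P)
    {U : ℝ≥0 → Ω → GaugeConfig 3 L (Matrix.specialUnitaryGroup (Fin 2) ℂ)} (hU0 : ∀ ω, U 0 ω = x)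
    (hU : (latticeLangevinDynamics (fundamentalLatticeRep 2) β').IsSolution (fundamentalRep (Fin 2)) hW.natFiltration P W U)
    {ι : Type} [Fintype ι]
    {G : ι → GaugeConfig 3 L (Matrix.specialUnitaryGroup (Fin 2) ℂ) → ℝ} (hGc : ∀ i, Continuous (G i)) (hG1 : ∀ i z, |G i z| ≤ 1)
    {S : Matrix ι ι ℝ}
    (hS : S = fun i j => ∫ t in Ioi (0 : ℝ),
      (∫ y, ((G i y - ∫ z, G i z ∂(wilsonMeasure (d := 3) (L := L) (fundamentalRep (Fin 2)) β')) *
          (∫ z, (G j z - ∫ z', G j z' ∂(wilsonMeasure (d := 3) (L := L) (fundamentalRep (Fin 2)) β')) ∂(κ t.toNNReal y)) +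
        (G j y - ∫ z, G j z ∂(wilsonMeasure (d := 3) (L := L) (fundamentalRep (Fin 2)) β')) *
          (∫ z, (G i z - ∫ z', G i z' ∂(wilsonMeasure (d := 3) (L := L) (fundamentalRep (Fin 2)) β')) ∂(κ t.toNNReal y)))
        ∂(wilsonMeasure (d := 3) (L := L) (fundamentalRep (Fin 2)) β')))
    (a : ι → ℝ) (ha : ∑ i, |a i| ≤ 1)
    (b : ℕ → ℝ) (J : ℕ → ℕ) (hb : ∀ n, 0 < b n) (hJ : ∀ n, 1 ≤ J n)
    (hb_top : Tendsto b atTop atTop) (hJ_top : Tendsto (fun n => (J n : ℝ)) atTop atTop)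
    (hbJ : Tendsto (fun n => b n / J n) atTop (𝓝 0)) :
    (∀ n, AEMeasurable (fun ω => b n / J n * ∑ j ∈ Finset.range (J n),
        ((∫ r in Ioc ((j : ℝ) * b n) (((j : ℝ) + 1) * b n), (∑ i, a i * G i (U r.toNNReal ω))) / b n -
          ((J n : ℝ) * b n)⁻¹ * ∑ j' ∈ Finset.range (J n),
            ∫ r in Ioc ((j' : ℝ) * b n) (((j' : ℝ) + 1) * b n), (∑ i, a i * G i (U r.toNNReal ω))) ^ 2) P) ∧
    TendstoInMeasure P (fun n ω => b n / J n * ∑ j ∈ Finset.range (J n),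
        ((∫ r in Ioc ((j : ℝ) * b n) (((j : ℝ) + 1) * b n), (∑ i, a i * G i (U r.toNNReal ω))) / b n -
          ((J n : ℝ) * b n)⁻¹ * ∑ j' ∈ Finset.range (J n),
            ∫ r in Ioc ((j' : ℝ) * b n) (((j' : ℝ) + 1) * b n), (∑ i, a i * G i (U r.toNNReal ω))) ^ 2)
      atTop (fun _ => a ⬝ᵥ S *ᵥ a) := by
  classical
  have hGac : Continuous fun z => ∑ i, a i * G i z := continuous_finsetSum _ fun i _ => continuous_const.mul (hGc i)
  have hGa1 : ∀ z, |∑ i, a i * G i z| ≤ 1 := fun z =>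
    calc |∑ i, a i * G i z| ≤ ∑ i, |a i * G i z| := Finset.abs_sum_le_sum_abs _ _
      _ ≤ ∑ i, |a i| := Finset.sum_le_sum fun i _ => by
          rw [abs_mul]
          calc |a i| * |G i z| ≤ |a i| * 1 := mul_le_mul_of_nonneg_left (hG1 i z) (abs_nonneg _)
            _ = |a i| := mul_one _
      _ ≤ 1 := ha
  have hσ2 := dotProduct_mulVec_greenKubo_eq L β' κ hreal hGc hG1 hS a
  obtain ⟨-, hm, hP⟩ := tendstoInMeasure_centredBatchMeans L β' κ hreal x hW hU0 hU hGac hGa1 hσ2 b J hb hJ hb_top hJ_top hbJ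
  exact ⟨hm, hP⟩

/-- ★★★ **The polarised batch-covariance estimator is consistent**: with `a± = (eₖ ± e_l)/2` (`Σ|a±| ≤ 1`), the difference of the two centred
batch-means estimators of `Σᵢ a±ᵢ Gᵢ` converges in probability to the entry `S k l` of the Green–Kubo covariance matrix. [folklore] -/
theorem tendstoInMeasure_batchCovariance (L : ℕ) [NeZero L] (β' : ℝ)
    (κ : ℝ≥0 → Kernel (GaugeConfig 3 L (Matrix.specialUnitaryGroup (Fin 2) ℂ))
      (GaugeConfig 3 L (Matrix.specialUnitaryGroup (Fin 2) ℂ))) [∀ t, IsMarkovKernel (κ t)]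
    (hreal : ∀ (t : ℝ≥0) (x : GaugeConfig 3 L (Matrix.specialUnitaryGroup (Fin 2) ℂ))
        (Ω : Type) [MeasurableSpace Ω] (P : Measure Ω) [IsProbabilityMeasure P]
        (W : ℝ≥0 → Ω → (Edge 3 L × NoiseIdx 2 → ℝ)) (hW : IsFlatBrownian W P)
        (U : ℝ≥0 → Ω → GaugeConfig 3 L (Matrix.specialUnitaryGroup (Fin 2) ℂ)),
        (∀ ω, U 0 ω = x) →
        (latticeLangevinDynamics (fundamentalLatticeRep 2) β').IsSolution (fundamentalRep (Fin 2))
          hW.natFiltration P W U →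
        κ t x = P.map (U t))
    (x : GaugeConfig 3 L (Matrix.specialUnitaryGroup (Fin 2) ℂ))
    {Ω : Type} [MeasurableSpace Ω] {P : Measure Ω} [IsProbabilityMeasure P]
    {W : ℝ≥0 → Ω → (Edge 3 L × NoiseIdx 2 → ℝ)} (hW : IsFlatBrownian W P)
    {U : ℝ≥0 → Ω → GaugeConfig 3 L (Matrix.specialUnitaryGroup (Fin 2) ℂ)} (hU0 : ∀ ω, U 0 ω = x)
    (hU : (latticeLangevinDynamics (fundamentalLatticeRep 2) β').IsSolution (fundamentalRep (Fin 2)) hW.natFiltration P W U)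
    {ι : Type} [Fintype ι] [DecidableEq ι]
    {G : ι → GaugeConfig 3 L (Matrix.specialUnitaryGroup (Fin 2) ℂ) → ℝ} (hGc : ∀ i, Continuous (G i)) (hG1 : ∀ i z, |G i z| ≤ 1)
    {S : Matrix ι ι ℝ}
    (hS : S = fun i j => ∫ t in Ioi (0 : ℝ),
      (∫ y, ((G i y - ∫ z, G i z ∂(wilsonMeasure (d := 3) (L := L) (fundamentalRep (Fin 2)) β')) *
          (∫ z, (G j z - ∫ z', G j z' ∂(wilsonMeasure (d := 3) (L := L) (fundamentalRep (Fin 2)) β')) ∂(κ t.toNNReal y)) +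
        (G j y - ∫ z, G j z ∂(wilsonMeasure (d := 3) (L := L) (fundamentalRep (Fin 2)) β')) *
          (∫ z, (G i z - ∫ z', G i z' ∂(wilsonMeasure (d := 3) (L := L) (fundamentalRep (Fin 2)) β')) ∂(κ t.toNNReal y)))
        ∂(wilsonMeasure (d := 3) (L := L) (fundamentalRep (Fin 2)) β')))
    (k l : ι)
    (b : ℕ → ℝ) (J : ℕ → ℕ) (hb : ∀ n, 0 < b n) (hJ : ∀ n, 1 ≤ J n)
    (hb_top : Tendsto b atTop atTop) (hJ_top : Tendsto (fun n => (J n : ℝ)) atTop atTop)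
    (hbJ : Tendsto (fun n => b n / J n) atTop (𝓝 0)) :
    (∀ n, AEMeasurable (fun ω =>
      b n / J n * ∑ j ∈ Finset.range (J n),
        ((∫ r in Ioc ((j : ℝ) * b n) (((j : ℝ) + 1) * b n),
            (∑ i, ((if i = k then 1 / 2 else 0) + (if i = l then 1 / 2 else 0)) * G i (U r.toNNReal ω))) / b n -
          ((J n : ℝ) * b n)⁻¹ * ∑ j' ∈ Finset.range (J n), ∫ r in Ioc ((j' : ℝ) * b n) (((j' : ℝ) + 1) * b n),
            (∑ i, ((if i = k then 1 / 2 else 0) + (if i = l then 1 / 2 else 0)) * G i (U r.toNNReal ω))) ^ 2 -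
      b n / J n * ∑ j ∈ Finset.range (J n),
        ((∫ r in Ioc ((j : ℝ) * b n) (((j : ℝ) + 1) * b n),
            (∑ i, ((if i = k then 1 / 2 else 0) - (if i = l then 1 / 2 else 0)) * G i (U r.toNNReal ω))) / b n -
          ((J n : ℝ) * b n)⁻¹ * ∑ j' ∈ Finset.range (J n), ∫ r in Ioc ((j' : ℝ) * b n) (((j' : ℝ) + 1) * b n),
            (∑ i, ((if i = k then 1 / 2 else 0) - (if i = l then 1 / 2 else 0)) * G i (U r.toNNReal ω))) ^ 2) P) ∧
    TendstoInMeasure P (fun n ω =>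
      b n / J n * ∑ j ∈ Finset.range (J n),
        ((∫ r in Ioc ((j : ℝ) * b n) (((j : ℝ) + 1) * b n),
            (∑ i, ((if i = k then 1 / 2 else 0) + (if i = l then 1 / 2 else 0)) * G i (U r.toNNReal ω))) / b n -
          ((J n : ℝ) * b n)⁻¹ * ∑ j' ∈ Finset.range (J n), ∫ r in Ioc ((j' : ℝ) * b n) (((j' : ℝ) + 1) * b n),
            (∑ i, ((if i = k then 1 / 2 else 0) + (if i = l then 1 / 2 else 0)) * G i (U r.toNNReal ω))) ^ 2 -
      b n / J n * ∑ j ∈ Finset.range (J n),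
        ((∫ r in Ioc ((j : ℝ) * b n) (((j : ℝ) + 1) * b n),
            (∑ i, ((if i = k then 1 / 2 else 0) - (if i = l then 1 / 2 else 0)) * G i (U r.toNNReal ω))) / b n -
          ((J n : ℝ) * b n)⁻¹ * ∑ j' ∈ Finset.range (J n), ∫ r in Ioc ((j' : ℝ) * b n) (((j' : ℝ) + 1) * b n),
            (∑ i, ((if i = k then 1 / 2 else 0) - (if i = l then 1 / 2 else 0)) * G i (U r.toNNReal ω))) ^ 2)
      atTop (fun _ => S k l) := by
  classical
  set ap : ι → ℝ := fun i => (if i = k then 1 / 2 else 0) + (if i = l then 1 / 2 else 0) with hap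
  set am : ι → ℝ := fun i => (if i = k then 1 / 2 else 0) - (if i = l then 1 / 2 else 0) with ham
  have hhalf : ∀ i, |(if i = k then (1 : ℝ) / 2 else 0)| = (if i = k then 1 / 2 else 0) := fun i => by split_ifs <;> simp
  have hhalf' : ∀ i, |(if i = l then (1 : ℝ) / 2 else 0)| = (if i = l then 1 / 2 else 0) := fun i => by split_ifs <;> simp
  have hsumk : ∑ i, (if i = k then (1 : ℝ) / 2 else 0) = 1 / 2 := by simp
  have hsuml : ∑ i, (if i = l then (1 : ℝ) / 2 else 0) = 1 / 2 := by simp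
  have hap1 : ∑ i, |ap i| ≤ 1 := by
    calc ∑ i, |ap i| ≤ ∑ i, (|(if i = k then (1 : ℝ) / 2 else 0)| + |(if i = l then (1 : ℝ) / 2 else 0)|) :=
          Finset.sum_le_sum fun i _ => abs_add_le _ _
      _ = 1 := by simp_rw [hhalf, hhalf']; rw [Finset.sum_add_distrib, hsumk, hsuml]; norm_num
  have ham1 : ∑ i, |am i| ≤ 1 := by
    calc ∑ i, |am i| ≤ ∑ i, (|(if i = k then (1 : ℝ) / 2 else 0)| + |(if i = l then (1 : ℝ) / 2 else 0)|) :=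
          Finset.sum_le_sum fun i _ => abs_sub _ _
      _ = 1 := by simp_rw [hhalf, hhalf']; rw [Finset.sum_add_distrib, hsumk, hsuml]; norm_num
  obtain ⟨hmp, hPp⟩ := tendstoInMeasure_batchMeans_combination L β' κ hreal x hW hU0 hU hGc hG1 hS ap hap1 b J hb hJ hb_top hJ_top hbJ
  obtain ⟨hmm, hPm⟩ := tendstoInMeasure_batchMeans_combination L β' κ hreal x hW hU0 hU hGc hG1 hS am ham1 b J hb hJ hb_top hJ_top hbJ
  -- polarisation identity `apᵀ S ap − amᵀ S am = S k l` (`S` is symmetric)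
  have hsym : ∀ i j, S i j = S j i := fun i j => by
    rw [hS]
    exact integral_congr_ae (ae_of_all _ fun t => integral_congr_ae (ae_of_all _ fun y => by ring))
  have hpol : ap ⬝ᵥ S *ᵥ ap - am ⬝ᵥ S *ᵥ am = S k l := by
    have hdiff : ∀ i j, ap i * (S i j * ap j) - am i * (S i j * am j) =
        S i j * ((if i = k then 1 / 2 else 0) * (if j = l then 1 / 2 else 0) + (if i = l then 1 / 2 else 0) * (if j = k then 1 / 2 else 0)) * 2 :=
      fun i j => by simp only [hap, ham]; ring
    simp only [dotProduct, mulVec, Finset.mul_sum]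
    rw [← Finset.sum_sub_distrib]
    simp_rw [← Finset.sum_sub_distrib, hdiff]
    simp only [mul_add, add_mul, Finset.sum_add_distrib, mul_ite, mul_zero, ite_mul, zero_mul, Finset.sum_ite_eq',
      Finset.mem_univ, if_true]
    rw [hsym l k]
    ring
  refine ⟨fun n => (hmp n).sub (hmm n), ?_⟩
  rw [← hpol]
  exact tendstoInMeasure_sub_of_const hPp hPm

end Summit.QuantumFields.YangMills.Theorems.ColdStartUniversality

end
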